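import Mathlib
import Summits.Ventures.HodgeRepro2.T5UnramifiedIntegralBasis

/-!
# The involution MOVES the residue of `θ`: `σ̄ θ̄ ≠ θ̄` from «the fixed elements come from `R`»

`T5UnramifiedIntegralBasis` still asks for `θ` with `θ̄ ∉ k_R` AND `σ̄ θ̄ ≠ θ̄`.  Here both are
derived from structural hypotheses:

* `exists_residue_notMem_range`: `|k_R| = q < q² = |k_S|` ⇒ some `θ ∈ S` has `θ̄ ∉ k_R`
  (the residue map `k_R → k_S` is injective, so it is not onto);
* `mem_range_of_add_self_mem_of_mul_self_mem` (the FIELD-LEVEL CORE): `f : K → L` fields, `K`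
  finite, `t ∈ L` with `2t ∈ f(K)` and `t² ∈ f(K)` ⇒ `t ∈ f(K)` — in characteristic `≠ 2`,
  `t = (2t)/2`; in characteristic `2`, `t² = f(c)²` for some `c` (every element of a finite field
  of characteristic `2` is a square) and `(t − f c)² = t² − f(c)² = 0`;
* `residue_sub_conj_ne_zero`: `σ` an involution of `S` whose FIXED elements lie in the image of
  `R`; then `θ̄ ∉ k_R` forces `σ̄ θ̄ ≠ θ̄` — for `θ + σ θ` and `θ · σ θ` are fixed, so if
  `σ̄ θ̄ = θ̄` then `2 θ̄` and `θ̄²` lie in `k_R`, hence so does `θ̄`;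
* the capstones of N5.15.2 (A15) / N5.T3 on the hypotheses (`Module.Finite R S`, `e = 1`,
  `|k_R| = q ≥ 2`, `|k_S| = q²`, `σ` an involution fixing `R` and NOTHING ELSE) — no `θ` in the
  statement any more.

Declaration per README §8(d): «uses an L-value-free non-vanishing device: NO».
-/

namespace Summit.Ventures.HodgeRepro2.T5ResidueConjugate

open T5FiltrationHilbert90 T5PrincipalUnitFiltration IsLocalRing

section Field

variable {K L : Type*} [Field K] [Field L]

/-- FIELD-LEVEL CORE: `K` finite, `t ∈ L` with `t + t ∈ f(K)` and `t · t ∈ f(K)` ⇒ `t ∈ f(K)`. -/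
theorem mem_range_of_add_self_mem_of_mul_self_mem [Finite K] (f : K →+* L) {t : L}
    (h2 : t + t ∈ Set.range f) (hsq : t * t ∈ Set.range f) : t ∈ Set.range f := by
  obtain ⟨a, ha⟩ := h2
  obtain ⟨b, hb⟩ := hsq
  by_cases htwo : (2 : L) = 0
  · -- characteristic 2: `b = c²` in `K`, then `(t − f c)² = t² − f(c)² = 0`
    have h2K : (2 : K) = 0 := by
      apply f.injective
      rw [map_ofNat, map_zero]
      exact htwo
    have hchar : ringChar K = 2 :=
      CharP.ringChar_of_prime_eq_zero Nat.prime_two (by exact_mod_cast h2K)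
    obtain ⟨c, hc⟩ := FiniteField.isSquare_of_char_two hchar b
    refine ⟨c, ?_⟩
    have hsq : (t - f c) * (t - f c) = 0 := by
      have hb' : t * t = f c * f c := by rw [← hb, hc, map_mul]
      linear_combination hb' + (f c * f c - t * f c) * htwo
    have := mul_self_eq_zero.1 hsq
    exact (sub_eq_zero.1 this).symm
  · -- characteristic ≠ 2: `t = (2t) / 2`
    refine ⟨a / 2, ?_⟩
    rw [map_div₀, map_ofNat, ha, div_eq_iff htwo]
    ring

/-- `|K| = q < q² = |L|` (`q ≥ 2`): the field map `K → L` is not onto. -/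
theorem not_surjective_of_card [Finite L] (f : K →+* L) {q : ℕ} (hq : 2 ≤ q)
    (hK : Nat.card K = q) (hL : Nat.card L = q ^ 2) : ¬ Function.Surjective f := by
  intro hsurj
  have hbij : Function.Bijective f := ⟨f.injective, hsurj⟩
  have := Nat.card_eq_of_bijective f hbij
  rw [hK, hL] at this
  nlinarith

end Field

section Residue

variable {R S : Type*} [CommRing R] [CommRing S] [Algebra R S] [IsLocalRing R] [IsLocalRing S]
  [IsLocalHom (algebraMap R S)]

/-- `|k_R| = q < q² = |k_S|` ⇒ some `θ ∈ S` has `θ̄ ∉ k_R`. -/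
theorem exists_residue_notMem_range {q : ℕ} (hq : 2 ≤ q) (hR : Nat.card (ResidueField R) = q)
    (hS : Nat.card (ResidueField S) = q ^ 2) :
    ∃ θ : S, residue S θ ∉ Set.range (ResidueField.map (algebraMap R S)) := by
  haveI : Finite (ResidueField S) := Nat.finite_of_card_ne_zero (by rw [hS]; positivity)
  have hns := not_surjective_of_card (ResidueField.map (algebraMap R S)) hq hR hS
  rw [Function.Surjective] at hns
  obtain ⟨z, hz⟩ := not_forall.1 hns
  obtain ⟨θ, rfl⟩ := residue_surjective z
  exact ⟨θ, fun ⟨a, ha⟩ => hz ⟨a, ha⟩⟩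

variable (σ : S ≃+* S)

/-- The residue of a `σ`-fixed element lies in `k_R` when the fixed elements come from `R`. -/
theorem residue_mem_range_of_fixed (hfix : ∀ s : S, σ s = s → ∃ r : R, s = algebraMap R S r)
    {s : S} (hs : σ s = s) : residue S s ∈ Set.range (ResidueField.map (algebraMap R S)) := by
  obtain ⟨r, rfl⟩ := hfix s hs
  exact ⟨residue R r, ResidueField.map_residue _ _⟩

/-- THE SEPARATION: `σ` an involution of `S` whose fixed elements come from `R`, `k_R` finite;
`θ̄ ∉ k_R` ⇒ `σ̄ θ̄ ≠ θ̄`, i.e. `θ − σ θ` is a UNIT. -/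
theorem residue_sub_conj_ne_zero [Finite (ResidueField R)] (hσσ : ∀ s, σ (σ s) = s)
    (hfix : ∀ s : S, σ s = s → ∃ r : R, s = algebraMap R S r) {θ : S}
    (hθ : residue S θ ∉ Set.range (ResidueField.map (algebraMap R S))) :
    residue S (θ - σ θ) ≠ 0 := by
  intro h
  have hσθ : residue S (σ θ) = residue S θ := by
    rw [map_sub, sub_eq_zero] at h
    exact h.symm
  apply hθ
  apply mem_range_of_add_self_mem_of_mul_self_mem (ResidueField.map (algebraMap R S))
  · have := residue_mem_range_of_fixed σ hfix (s := θ + σ θ) (by rw [map_add, hσσ, add_comm])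
    rwa [map_add, hσθ] at this
  · have := residue_mem_range_of_fixed σ hfix (s := θ * σ θ) (by rw [map_mul, hσσ, mul_comm])
    rwa [map_mul, hσθ] at this

/-- `θ − σ θ` is a unit. -/
theorem isUnit_sub_conj [Finite (ResidueField R)] (hσσ : ∀ s, σ (σ s) = s)
    (hfix : ∀ s : S, σ s = s → ∃ r : R, s = algebraMap R S r) {θ : S}
    (hθ : residue S θ ∉ Set.range (ResidueField.map (algebraMap R S))) :
    IsUnit (θ - σ θ) :=
  (residue_ne_zero_iff_isUnit _).1 (residue_sub_conj_ne_zero σ hσσ hfix hθ)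

/-- EXISTENCE of the unramified integral basis element: `θ` with `θ̄ ∉ k_R` and `θ − σ θ` a unit,
from the cardinalities and «the fixed elements come from `R`». -/
theorem exists_residue_notMem_range_and_isUnit_sub_conj (hσσ : ∀ s, σ (σ s) = s)
    (hfix : ∀ s : S, σ s = s → ∃ r : R, s = algebraMap R S r) {q : ℕ} (hq : 2 ≤ q)
    (hR : Nat.card (ResidueField R) = q) (hS : Nat.card (ResidueField S) = q ^ 2) :
    ∃ θ : S, residue S θ ∉ Set.range (ResidueField.map (algebraMap R S)) ∧ IsUnit (θ - σ θ) := by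
  haveI : Finite (ResidueField R) := Nat.finite_of_card_ne_zero (by rw [hR]; omega)
  obtain ⟨θ, hθ⟩ := exists_residue_notMem_range hq hR hS
  exact ⟨θ, hθ, isUnit_sub_conj σ hσσ hfix hθ⟩

end Residue

section DVR

variable {R S : Type*} [CommRing R] [CommRing S] [Algebra R S] [IsDomain R] [IsDomain S]
  [IsDiscreteValuationRing R] [IsDiscreteValuationRing S] [IsLocalHom (algebraMap R S)]
  [Module.Finite R S] (σ : S ≃+* S)

/-- THE UNRAMIFIED INTEGRAL BASIS exists: DVRs `R ⊆ S`, `S` finite over `R`, `e = 1`, `|k_R| = q ≥ 2`,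
`|k_S| = q²`, `σ` an involution fixing exactly the image of `R` ⇒ ∃ θ, `θ − σ θ` a unit and
`S = R ⊕ R θ`. -/
theorem exists_integralBasis (hσσ : ∀ s, σ (σ s) = s)
    (hfix : ∀ s : S, σ s = s → ∃ r : R, s = algebraMap R S r) {ϖ : R} (hϖ : Irreducible ϖ)
    (hϖS : Irreducible (algebraMap R S ϖ)) {q : ℕ} (hq : 2 ≤ q)
    (hR : Nat.card (ResidueField R) = q) (hS : Nat.card (ResidueField S) = q ^ 2) :
    ∃ θ : S, IsUnit (θ - σ θ) ∧ ∀ s : S, ∃ a b : R, s = algebraMap R S a + algebraMap R S b * θ := by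
  obtain ⟨θ, hθ, hu⟩ := exists_residue_notMem_range_and_isUnit_sub_conj σ hσσ hfix hq hR hS
  exact ⟨θ, hu, T5UnramifiedIntegralBasis.exists_eq_add_mul hϖ hϖS (by omega) hR hS hθ⟩

/-- N5.15.2 (A15) / N5.T3: `[E¹ : E¹ ∩ U^n] = (q+1)q^{n−1}` (`n ≥ 1`) — no `θ` in the statement. -/
theorem relIndex_range_inf_higherUnits_eq
    (hσR : ∀ r : R, σ (algebraMap R S r) = algebraMap R S r) (hσσ : ∀ s, σ (σ s) = s)
    (hfix : ∀ s : S, σ s = s → ∃ r : R, s = algebraMap R S r)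
    (hinj : Function.Injective (algebraMap R S)) {ϖ : R} (hϖ : Irreducible ϖ)
    (hϖS : Irreducible (algebraMap R S ϖ)) {q : ℕ} (hq : 2 ≤ q)
    (hR : Nat.card (ResidueField R) = q) (hS : Nat.card (ResidueField S) = q ^ 2) {n : ℕ}
    (hn : 1 ≤ n) :
    ((MonoidHom.mk' (conjQuot σ) (conjQuot_mul σ)).range ⊓
        higherUnits (algebraMap R S ϖ) n).relIndex
        (MonoidHom.mk' (conjQuot σ) (conjQuot_mul σ)).range = (q + 1) * q ^ (n - 1) := by
  haveI : Finite (ResidueField R) := Nat.finite_of_card_ne_zero (by rw [hR]; omega)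
  obtain ⟨θ, hθ⟩ := exists_residue_notMem_range hq hR hS
  exact T5UnramifiedIntegralBasis.relIndex_range_inf_higherUnits_eq σ hσR hσσ hθ
    (residue_sub_conj_ne_zero σ hσσ hfix hθ) hinj hϖ hϖS hq hR hS hn

/-- `|E¹/(E¹ ∩ U²)| = (q+1)q`. -/
theorem relIndex_range_inf_higherUnits_two
    (hσR : ∀ r : R, σ (algebraMap R S r) = algebraMap R S r) (hσσ : ∀ s, σ (σ s) = s)
    (hfix : ∀ s : S, σ s = s → ∃ r : R, s = algebraMap R S r)
    (hinj : Function.Injective (algebraMap R S)) {ϖ : R} (hϖ : Irreducible ϖ)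
    (hϖS : Irreducible (algebraMap R S ϖ)) {q : ℕ} (hq : 2 ≤ q)
    (hR : Nat.card (ResidueField R) = q) (hS : Nat.card (ResidueField S) = q ^ 2) :
    ((MonoidHom.mk' (conjQuot σ) (conjQuot_mul σ)).range ⊓
        higherUnits (algebraMap R S ϖ) 2).relIndex
        (MonoidHom.mk' (conjQuot σ) (conjQuot_mul σ)).range = (q + 1) * q := by
  haveI : Finite (ResidueField R) := Nat.finite_of_card_ne_zero (by rw [hR]; omega)
  obtain ⟨θ, hθ⟩ := exists_residue_notMem_range hq hR hS
  exact T5UnramifiedIntegralBasis.relIndex_range_inf_higherUnits_two σ hσR hσσ hθ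
    (residue_sub_conj_ne_zero σ hσσ hfix hθ) hinj hϖ hϖS hq hR hS

/-- `|G/G¹| = |E¹/(E¹ ∩ U¹)| = q + 1`. -/
theorem relIndex_range_inf_higherUnits_one
    (hσR : ∀ r : R, σ (algebraMap R S r) = algebraMap R S r) (hσσ : ∀ s, σ (σ s) = s)
    (hfix : ∀ s : S, σ s = s → ∃ r : R, s = algebraMap R S r)
    (hinj : Function.Injective (algebraMap R S)) {ϖ : R} (hϖ : Irreducible ϖ)
    (hϖS : Irreducible (algebraMap R S ϖ)) {q : ℕ} (hq : 2 ≤ q)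
    (hR : Nat.card (ResidueField R) = q) (hS : Nat.card (ResidueField S) = q ^ 2) :
    ((MonoidHom.mk' (conjQuot σ) (conjQuot_mul σ)).range ⊓
        higherUnits (algebraMap R S ϖ) 1).relIndex
        (MonoidHom.mk' (conjQuot σ) (conjQuot_mul σ)).range = q + 1 := by
  haveI : Finite (ResidueField R) := Nat.finite_of_card_ne_zero (by rw [hR]; omega)
  obtain ⟨θ, hθ⟩ := exists_residue_notMem_range hq hR hS
  exact T5UnramifiedIntegralBasis.relIndex_range_inf_higherUnits_one σ hσR hσσ hθ
    (residue_sub_conj_ne_zero σ hσσ hfix hθ) hinj hϖ hϖS hq hR hS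

/-- `|G¹| = |(E¹ ∩ U¹)/(E¹ ∩ U²)| = q`. -/
theorem relIndex_inf_two_inf_one
    (hσR : ∀ r : R, σ (algebraMap R S r) = algebraMap R S r) (hσσ : ∀ s, σ (σ s) = s)
    (hfix : ∀ s : S, σ s = s → ∃ r : R, s = algebraMap R S r)
    (hinj : Function.Injective (algebraMap R S)) {ϖ : R} (hϖ : Irreducible ϖ)
    (hϖS : Irreducible (algebraMap R S ϖ)) {q : ℕ} (hq : 2 ≤ q)
    (hR : Nat.card (ResidueField R) = q) (hS : Nat.card (ResidueField S) = q ^ 2) :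
    ((MonoidHom.mk' (conjQuot σ) (conjQuot_mul σ)).range ⊓
        higherUnits (algebraMap R S ϖ) 2).relIndex
        ((MonoidHom.mk' (conjQuot σ) (conjQuot_mul σ)).range ⊓
          higherUnits (algebraMap R S ϖ) 1) = q := by
  haveI : Finite (ResidueField R) := Nat.finite_of_card_ne_zero (by rw [hR]; omega)
  obtain ⟨θ, hθ⟩ := exists_residue_notMem_range hq hR hS
  exact T5UnramifiedIntegralBasis.relIndex_inf_two_inf_one σ hσR hσσ hθ
    (residue_sub_conj_ne_zero σ hσσ hfix hθ) hinj hϖ hϖS hq hR hS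

end DVR

end Summit.Ventures.HodgeRepro2.T5ResidueConjugate
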